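import Literature.NumberTheory.LFunctions.GranvilleSoundararajan2003
import HarnessLib

/-!
# Granville–Soundararajan 2003, Theorem 4 as printed over-claims — a formal refutation

Topic `NumberTheory/LFunctions`; sibling of `GranvilleSoundararajan2003.lean`, which vendors the named
facts of A. Granville, K. Soundararajan, *Decay of mean values of multiplicative functions*, Canad. J.
Math. 55 (2003), 1191–1230 (arXiv:math/9911246; references.bib key `GranvilleSoundararajan2003`).

That file records **Theorem 4** three times: `GranvilleSoundararajan2003_theorem4` is the statement *as
printed* (arXiv p. 2: "Take `T = log x`, and suppose that the maximum in (1.3) occurs at `y₀`. Then for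
`1 ≤ w ≤ x/10`, we have `|x⁻¹ ∑_{n≤x} f(n)n^{-iy₀} - (w/x) ∑_{n≤x/w} f(n)n^{-iy₀}| ≪
(log 2w/log x)^{1-2/π} log(log x/log 2w) + (log log x)^{1+2(1-2/π)}/(log x)^{1-2/π}`"), refuted here;
`GranvilleSoundararajan2003_theorem4_sqrtRange` repairs the ranges (`1 ≤ w ≤ √x`, `x ≥ x₀` — the range
the bounds of §6 establish and the one §7 uses: "We may suppose that `w ≤ √x`, else there's nothing to
prove", arXiv p. 10) but still quantifies over every maximiser `y₀` of the window and is refuted too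
(`GranvilleSoundararajan2003_theorem4_sqrtRange_false`, `GranvilleSoundararajan2003Theorem4EdgeRefutation.lean`);
the corrected statement is `GranvilleSoundararajan2003_theorem4_central` (in addition `|y₀| ≤ log x`, the
case §6 proves), PROVED in tree (`GranvilleSoundararajan2003_theorem4_central_holds`,
`GranvilleSoundararajanTheorem4Proofs.lean`).  Since the verdict clean-up of 2026-08-15 both refuted
renderings are `@[deprecated]` in `GranvilleSoundararajan2003.lean` (statements kept verbatim as the
subjects of their refutations); this refutation must name `GranvilleSoundararajan2003_theorem4`, so the
deprecation linter is switched off on exactly the two declarations below that do.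

This file **proves** that the printed form is false,
`GranvilleSoundararajan2003_theorem4_false : ¬ GranvilleSoundararajan2003_theorem4`, so that the
defective named fact can never be discharged or relied upon.  As printed the statement fails near
`w ≍ x`: the main term `(log 2w/log x)^{1-2/π} log(log x/log 2w)` vanishes as `log 2w/log x → 1`, while
the left side keeps a discretisation term of size `≍ w/x`.  The simplest witness is the Dirichlet
identity `f = 1` (`f(1) = 1`, `f(n) = 0` for `n ≥ 2`; multiplicative, `|f| ≤ 1`): then `F ≡ 1`
(`truncEulerProduct_one`), so `y₀ = 0` is a maximiser of `|F(1+iy)|` on `|y| ≤ 2 log x`; with `w = x/10`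
both twisted sums equal `f(1) = 1` (`sum_Icc_one_twist_zero`), the left side is `|1/x - 1/10| ≥ 1/20`
for `x ≥ 20`, and the right side tends to `0` as `x → ∞` (`theorem4_rhs_tendsto_zero`), whatever the
implied constant.

## Content

* `truncEulerProduct_one` — for `f = 1`, `truncEulerProduct f x s = 1`.
* `sum_Icc_one_twist_zero` — for `f = 1` and `N ≥ 1`, `∑_{n ∈ Icc 1 N} f(n) n^{-i·0} = 1`.
* `theorem4_rhs_tendsto_zero` — the printed right-hand side at `w = x/10` tends to `0` (`x → ∞`).
* `GranvilleSoundararajan2003_theorem4_false` — `¬ GranvilleSoundararajan2003_theorem4` (PROVED);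
  `not_GranvilleSoundararajan2003_theorem4` — the same under the conventional `not_<decl>` name.

Deliberately not here: the corrected statement (`GranvilleSoundararajan2003_theorem4_central`, proved in
`GranvilleSoundararajanTheorem4Proofs.lean` from the paper's Proposition 3.3, Lemmas 2.1–2.3 and §6) and the
refutation of the every-maximiser reading (`GranvilleSoundararajan2003Theorem4EdgeRefutation.lean`).

## References

* A. Granville, K. Soundararajan, *Decay of mean values of multiplicative functions*, Canad. J. Math.
  55 (2003), no. 6, 1191–1230, doi:10.4153/CJM-2003-047-0; arXiv:math/9911246 — Theorem 4 (arXiv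
  p. 2), §6 (proof of Theorem 4, arXiv p. 9), §7 (arXiv p. 10, the reduction to `w ≤ √x`).
-/

noncomputable section

open Finset Filter Complex

namespace Literature.NumberTheory.LFunctions.GranvilleSoundararajan

/-- For the Dirichlet identity `f = 1` (`f(1) = 1`, `f(n) = 0` otherwise) every Euler factor is `1`,
so the truncated Euler product is `F ≡ 1`. [folklore] -/
theorem truncEulerProduct_one (x : ℝ) (s : ℂ) :
    truncEulerProduct (⇑(1 : ArithmeticFunction ℂ)) x s = 1 := by
  unfold truncEulerProduct
  refine Finset.prod_eq_one fun p hp => ?_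
  have hp2 : 2 ≤ p := (Nat.mem_primesBelow.1 hp).2.two_le
  unfold eulerFactor
  rw [tsum_eq_single 0]
  · simp
  · intro k hk
    have h1 : p ^ k ≠ 1 := (one_lt_pow₀ (by omega : 1 < p) hk).ne'
    rw [ArithmeticFunction.one_apply, if_neg h1, zero_mul]

/-- For `f = 1` the partial sums twisted by `n^{-iy₀}` at `y₀ = 0` equal `1` once `N ≥ 1`.
[folklore] -/
theorem sum_Icc_one_twist_zero {N : ℕ} (hN : 1 ≤ N) :
    ∑ n ∈ Icc 1 N, (1 : ArithmeticFunction ℂ) n * (n : ℂ) ^ (-(((0 : ℝ) : ℂ) * I)) = 1 := by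
  simp [ArithmeticFunction.one_apply, Finset.sum_ite_eq', hN]

/-- The right-hand side of the printed Theorem 4 at `w = x/10`,
`(log(x/5)/log x)^{1-2/π} log(log x/log(x/5)) + (log log x)^{1+2(1-2/π)}/(log x)^{1-2/π}`, tends to `0`
as `x → ∞` (first term `≤ log 5/log(x/5)` by `log t ≤ t - 1`; second term because `log` grows slower
than any power). [folklore] -/
theorem theorem4_rhs_tendsto_zero :
    Tendsto (fun x : ℝ =>
      (Real.log (2 * (x / 10)) / Real.log x) ^ (1 - 2 / Real.pi)
          * Real.log (Real.log x / Real.log (2 * (x / 10)))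
        + Real.log (Real.log x) ^ (1 + 2 * (1 - 2 / Real.pi)) / Real.log x ^ (1 - 2 / Real.pi))
      atTop (nhds 0) := by
  have h2π : (2 : ℝ) < Real.pi := by
    refine lt_of_le_of_ne Real.two_le_pi fun h => ?_
    have h0 := Real.cos_pi_div_two
    rw [← h, show (2 : ℝ) / 2 = 1 by norm_num] at h0
    exact Real.cos_one_pos.ne' h0
  have hα : 0 < 1 - 2 / Real.pi := by
    rwa [sub_pos, div_lt_one Real.pi_pos]
  -- the second term
  have hB : Tendsto (fun x : ℝ => Real.log (Real.log x) ^ (1 + 2 * (1 - 2 / Real.pi))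
      / Real.log x ^ (1 - 2 / Real.pi)) atTop (nhds 0) :=
    ((isLittleO_log_rpow_rpow_atTop (1 + 2 * (1 - 2 / Real.pi)) hα).tendsto_div_nhds_zero).comp
      Real.tendsto_log_atTop
  -- the first term, squeezed between `0` and `log 5 / log (2 (x/10))`
  have hv : Tendsto (fun x : ℝ => Real.log (2 * (x / 10))) atTop atTop :=
    Real.tendsto_log_atTop.comp
      ((tendsto_id.atTop_div_const (by norm_num : (0 : ℝ) < 10)).const_mul_atTop
        (by norm_num : (0 : ℝ) < 2))
  have hup : Tendsto (fun x : ℝ => Real.log 5 / Real.log (2 * (x / 10))) atTop (nhds 0) :=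
    tendsto_const_nhds.div_atTop hv
  have hA : Tendsto (fun x : ℝ => (Real.log (2 * (x / 10)) / Real.log x) ^ (1 - 2 / Real.pi)
      * Real.log (Real.log x / Real.log (2 * (x / 10)))) atTop (nhds 0) := by
    refine tendsto_of_tendsto_of_tendsto_of_le_of_le' tendsto_const_nhds hup ?_ ?_
    · filter_upwards [eventually_ge_atTop (10 : ℝ)] with x hx
      have hv0 : 0 < Real.log (2 * (x / 10)) := Real.log_pos (by linarith)
      have hvu : Real.log (2 * (x / 10)) ≤ Real.log x :=
        Real.log_le_log (by linarith) (by linarith)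
      have hu0 : 0 < Real.log x := hv0.trans_le hvu
      refine mul_nonneg (Real.rpow_nonneg (div_nonneg hv0.le hu0.le) _) (Real.log_nonneg ?_)
      rwa [one_le_div hv0]
    · filter_upwards [eventually_ge_atTop (10 : ℝ)] with x hx
      have hx0 : (0 : ℝ) < x := by linarith
      have hv0 : 0 < Real.log (2 * (x / 10)) := Real.log_pos (by linarith)
      have hvu : Real.log (2 * (x / 10)) ≤ Real.log x :=
        Real.log_le_log (by linarith) (by linarith)
      have hu0 : 0 < Real.log x := hv0.trans_le hvu
      have hdiff : Real.log x - Real.log (2 * (x / 10)) = Real.log 5 := by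
        rw [show 2 * (x / 10) = x / 5 by ring, Real.log_div hx0.ne' (by norm_num)]
        ring
      have hL0 : 0 ≤ Real.log (Real.log x / Real.log (2 * (x / 10))) :=
        Real.log_nonneg (by rwa [one_le_div hv0])
      calc (Real.log (2 * (x / 10)) / Real.log x) ^ (1 - 2 / Real.pi)
              * Real.log (Real.log x / Real.log (2 * (x / 10)))
          ≤ Real.log (Real.log x / Real.log (2 * (x / 10))) :=
            mul_le_of_le_one_left hL0
              (Real.rpow_le_one (div_nonneg hv0.le hu0.le) (div_le_one_of_le₀ hvu hu0.le) hα.le)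
        _ ≤ Real.log x / Real.log (2 * (x / 10)) - 1 :=
            Real.log_le_sub_one_of_pos (div_pos hu0 hv0)
        _ = Real.log 5 / Real.log (2 * (x / 10)) := by
            rw [← hdiff, sub_div, div_self hv0.ne']
  have h := hA.add hB
  rwa [add_zero] at h

-- names the `@[deprecated]` fact `GranvilleSoundararajan2003_theorem4` on purpose: this IS its refutation
-- (verdict clean-up 2026-08-15); REMOVE-WHEN the deprecated def is deleted from `GranvilleSoundararajan2003.lean`.
set_option linter.deprecated false in
/-- **The faithful rendering of the printed Theorem 4 is false** (hence can never be discharged):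
`¬ GranvilleSoundararajan2003_theorem4`.  Witness: `f = 1` (the Dirichlet identity, multiplicative
with `|f| ≤ 1`), for which `F ≡ 1` (`truncEulerProduct_one`), so `y₀ = 0` maximises `|F(1+iy)|` on
`|y| ≤ 2 log x`; `w = x/10` (so `⌊x/w⌋ = 10` and both twisted sums equal `f(1) = 1`); then the left
side is `|1/x - 1/10| ≥ 1/20` for `x ≥ 20`, whereas `C ·`(right side) `→ 0` as `x → ∞`
(`theorem4_rhs_tendsto_zero`), whatever the constant `C`.  The source's printed range `1 ≤ w ≤ x/10`
(arXiv p. 2) thus over-claims by a discretisation effect at `w ≍ x`; the range actually established in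
§6 and used in §7 ("We may suppose that `w ≤ √x`") is `1 ≤ w ≤ √x`, `x` large, and the statement to
use is `GranvilleSoundararajan2003_theorem4_central` (that range, central maximisers `|y₀| ≤ log x`),
proved as `GranvilleSoundararajan2003_theorem4_central_holds`.  The refuted def is `@[deprecated]`
(verdict clean-up 2026-08-15) and this theorem must name it, whence `linter.deprecated` is off here.
[cite: GranvilleSoundararajan2003, Theorem 4 (arXiv p. 2) and §6–§7 (arXiv pp. 9–10)] -/
theorem GranvilleSoundararajan2003_theorem4_false : ¬ GranvilleSoundararajan2003_theorem4 := by
  rintro ⟨C, hC⟩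
  have hfb : ∀ n, ‖(1 : ArithmeticFunction ℂ) n‖ ≤ 1 := by
    intro n
    rw [ArithmeticFunction.one_apply]
    split_ifs <;> simp
  -- `C · RHS(x) → 0`, hence it is eventually `< 1/20`; pick such an `x ≥ 20`
  have hR := theorem4_rhs_tendsto_zero.const_mul C
  rw [mul_zero] at hR
  obtain ⟨x, hxR, hx20⟩ :=
    (((tendsto_order.1 hR).2 (1 / 20) (by norm_num)).and (eventually_ge_atTop (20 : ℝ))).exists
  have hx0 : (0 : ℝ) < x := by linarith
  have hx0' : x ≠ 0 := hx0.ne'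
  have hq : x / (x / 10) = 10 := by field_simp
  have hx1 : 1 ≤ ⌊x⌋₊ := Nat.le_floor (by rw [Nat.cast_one]; linarith)
  have hx2 : 1 ≤ ⌊x / (x / 10)⌋₊ := Nat.le_floor (by rw [Nat.cast_one, hq]; norm_num)
  have hy0 : |(0 : ℝ)| ≤ 2 * Real.log x := by
    rw [abs_zero]
    exact mul_nonneg zero_le_two (Real.log_nonneg (by linarith))
  have hmax : ∀ y : ℝ, |y| ≤ 2 * Real.log x →
      ‖truncEulerProduct (⇑(1 : ArithmeticFunction ℂ)) x (1 + y * I)‖ ≤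
        ‖truncEulerProduct (⇑(1 : ArithmeticFunction ℂ)) x (1 + ((0 : ℝ) : ℂ) * I)‖ := by
    intro y _
    rw [truncEulerProduct_one, truncEulerProduct_one]
  have hmain := hC 1 ArithmeticFunction.isMultiplicative_one hfb x (by linarith) 0 hy0 hmax
    (x / 10) (by linarith) le_rfl
  rw [sum_Icc_one_twist_zero hx1, sum_Icc_one_twist_zero hx2, mul_one, mul_one] at hmain
  -- the left side is `|1/x - 1/10| ≥ 1/20`
  have hL : (1 / 20 : ℝ) ≤ ‖(x : ℂ)⁻¹ - (((x / 10) / x : ℝ) : ℂ)‖ := by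
    rw [show (x / 10) / x = (1 / 10 : ℝ) by field_simp, ← Complex.ofReal_inv, ← Complex.ofReal_sub,
      Complex.norm_real, Real.norm_eq_abs]
    have hxinv : x⁻¹ ≤ (20 : ℝ)⁻¹ := inv_anti₀ (by norm_num) hx20
    rw [abs_sub_comm, abs_of_nonneg (by linarith)]
    linarith
  linarith

-- the alias must name the deprecated def too; REMOVE-WHEN the deprecated def is deleted.
set_option linter.deprecated false in
/-- Conventional name (`not_<decl>`) of the refutation of the deprecated named fact
`GranvilleSoundararajan2003_theorem4` (= `GranvilleSoundararajan2003_theorem4_false`).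
[cite: GranvilleSoundararajan2003, Theorem 4 (arXiv p. 2)] -/
theorem not_GranvilleSoundararajan2003_theorem4 : ¬ GranvilleSoundararajan2003_theorem4 :=
  GranvilleSoundararajan2003_theorem4_false

end Literature.NumberTheory.LFunctions.GranvilleSoundararajan
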